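import Summits.QuantumFields.BalabanUV.Beta.AxialDressingRooted
import Summits.QuantumFields.BalabanUV.Beta.GAN24.RespStepBmDecompExact

/-!
# `BalabanUV.Beta.D1BFx.ChargeFreeComposition` — road «BF-x» for binder row D1, slot (K), PART 24's ABEL STEP (the «one summation by parts per vertex» of
# `PART24-SPEC-g23.md` §2 R-BB ∕ R-AB): **A CHARGE-FREE KERNEL COMPOSED WITH A LEG SEES ONLY THE LEG's DIFFERENCES** — if every row of `A` sums to zero then
# `(A ∘ K)(x,z) = Σ'_y A(x,y)·(K(y,z) − K(x,z))`; if every column of `A` sums to zero then `(K ∘ A)(x,z) = Σ'_y (K(x,y) − K(x,p))·A(y,z)` for ANY base point `p`;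
# hence, when `A(·,z)` is supported where `|K(x,·) − K(x,p)| ≤ G`, `|(K ∘ A)(x,z)| ≤ G·Σ'_y |A(y,z)|` — and a kernel with unit differences `≤ G₁` in the second
# variable has `|K(x,y) − K(x,p)| ≤ G₁·|y − p|₁` (telescoping along the axial contour), so a stencil of `ℓ¹`-diameter `R` costs `G₁·R` instead of `sup |K|`

HONEST DEPENDENCY (cell records, verbatim): «continuum YM on T⁴ ⇐ BetaPertH ∧ nine spine estimates (0/9 proved); BetaPertH ⇐ (D1) ∧ (D4) ∧
CAP+tail; G-an2-4 gates asym, D1 and NE2/3/4.»  HONEST FRAMING (cell contract, verbatim): «discharging `BetaPertH` makes Bałaban's UV stability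
UNCONDITIONAL — a real constructive-QFT result; it is NOT the continuum limit and NOT the Clay problem.»  THIS MODULE is [folklore] `tsum` bookkeeping over an2's
`ExpKernelCalculus` (`comp`, `MKer`) and lit-balaban's axial contour (`AveragingContours.axial_sum_grad ∕ axial_length`, an2's `AxialDressingRooted.mem_axial`, gan24's
`RespStepBmDecompExact.abs_list_sum_le`); `A`, `K`, `G` are ARBITRARY; no `def`, no `def … : Prop`, nothing cited, 0 sorry.  WHAT IT IS: the generic Abel step the OWNER
d1-p2 g23's spec assigns to this seat («R-BB, R-AB (L, road + leaf-01's Abel step `g28/diffcur/ChargeFreeComposition.draft.lean`)»; COMMISSION C-g23-1), in BOTH orientations,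
with the Lipschitz packaging that turns the leg letters L-B′ (`RestLegSandwichGradient`: unit differences `≤ K′∕n³·e^{…}`) and L-h (`MinimiserColumnGradient`) into the «one gain per
vertex» of §1 of the spec once L-w (the cubic table's charge form — an3∕GAN24 letters, the OWNER's adapter) says which index is charge-free.  WHAT IT IS NOT: NOT L-w (no Wilson table
is opened here); NOT a (1.22) row (R-BB ∕ R-AB are the OWNER's read-outs); 0 root-level binders of row D1 discharged (hW ∕ hR-sockets ∕ hSX-socket ∕ D1Tel ∕ D1Rep = 0); (K) NOT
closed; NOT D1, NOT `BetaPertH`, NOT continuum, NOT Clay.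

ABSOLUTE RULE (cell charter, verbatim): «No internally-minted statement may enter as a cited fact. Every hypothesis is either kernel-proved in
this package or a verbatim quotation of a PUBLISHED theorem with page reference. The manuscript(s) under audit are NOT citable for their own
disputed steps — they are the thing under adjudication; programme-internal (2001/route/tribunal) claims are never citable.»

CONTENT ([folklore]; `D`, `F` arbitrary).
* §1 ROW-CHARGE-FREE LEFT FACTOR: **`comp_eq_tsum_mul_sub`** (`(A ∘ K)(x,z)_{ab} = Σ'_y Σ_f A(x,y)_{af}·(K(y,z)_{fb} − K(x,z)_{fb})`), **`abs_comp_le_tsum_abs_mul_abs_sub`**.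
* §2 COLUMN-CHARGE-FREE RIGHT FACTOR, ANY BASE POINT `p`: **`comp_eq_tsum_sub_mul`** (`(K ∘ A)(x,z)_{ab} = Σ'_y Σ_f (K(x,y)_{af} − K(x,p)_{af})·A(y,z)_{fb}`),
  **`abs_comp_le_tsum_abs_sub_mul_abs`**, and the SUPPORT PACKAGING **`abs_comp_le_mul_tsum_of_support`** (`|K(x,y) − K(x,p)| ≤ G` wherever `A(y,z) ≠ 0` ⟹ `|(K ∘ A)(x,z)_{ab}| ≤ G·Σ'_y Σ_f |A(y,z)_{fb}|`).
* §3 LIPSCHITZ FROM UNIT STEPS: **`abs_sub_le_mul_l1Dist_of_unitDiff_le`** (`|f y − f p| ≤ G₁·Σ_i |y_i − p_i|` from `|f (w + e_κ) − f w| ≤ G₁`, by the axial contour `Γ_{p,y}`).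
* §4 THE SCALAR TWIN ALONG ONE AXIS (leaf-04 g25's STEP A form; OWNER W-g23-12 (4) «one file»): **`tsum_mul_sub_eq_neg_tsum_sub_mul`** (`Σ' c·(T(·+e) − T) = −Σ' (c − c(·−e))·T`).
Unit `b2b-balaban-beta-d1-formalise-leaf-01` (gen 29; §1 drafted gen 28), D1 formalisation swarm LEAF PROVER 01, road «BF-x»; COMMISSION C-g23-1; INTENT «ABEL STEP» (journal).
Not in print; our bookkeeping.  No existing file touched.
-/

noncomputable section

open scoped BigOperators

namespace Summit.QuantumFields.BalabanUV.Beta.D1BFx.ChargeFreeComposition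

open Literature.MathematicalPhysics.QuantumFieldTheory.Balaban1983to89.Beta
open ExpKernelCalculus (Site MKer comp)
open AffineAveraging (Form1 unitVec)
open AveragingContours (grad axial axial_sum_grad axial_length)
open Summit.QuantumFields.BalabanUV.Beta.AxialDressingRooted (mem_axial)
open Summit.QuantumFields.BalabanUV.Beta.GAN24.RespStepBmDecompExact (abs_list_sum_le)

variable {D : ℕ} {F : Type*} [Fintype F]

/-! ## §1 Row-charge-free LEFT factor: the leg enters through its differences from the row's base point -/

/-- [folklore] **ABEL SUMMATION FOR A ROW-CHARGE-FREE KERNEL**: if the row `(x, a, ·)` of `A` is summable with total `0` in every fibre column `f`, and the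
products with the leg's column are summable, then `(A ∘ K)(x,z)_{ab} = Σ'_y Σ_f A(x,y)_{af}·(K(y,z)_{fb} − K(x,z)_{fb})`. -/
theorem comp_eq_tsum_mul_sub {A K : MKer D F} (x z : Site D) (a b : F)
    (hA0 : ∀ f, ∑' y : Site D, A x y a f = 0) (hAs : ∀ f, Summable fun y : Site D => A x y a f)
    (hAK : ∀ f, Summable fun y : Site D => A x y a f * K y z f b) :
    comp A K x z a b = ∑' y : Site D, ∑ f, A x y a f * (K y z f b - K x z f b) := by
  have hsub : ∀ f, Summable fun y : Site D => A x y a f * (K y z f b - K x z f b) := fun f => by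
    have h := (hAK f).sub ((hAs f).mul_right (K x z f b))
    refine h.congr fun y => ?_
    ring
  have hzero : ∀ f, ∑' y : Site D, A x y a f * K x z f b = 0 := fun f => by
    rw [tsum_mul_right, hA0 f, zero_mul]
  calc comp A K x z a b = ∑' y : Site D, ∑ f, A x y a f * K y z f b := rfl
    _ = ∑ f, ∑' y : Site D, A x y a f * K y z f b := Summable.tsum_finsetSum (fun f _ => hAK f)
    _ = ∑ f, ((∑' y : Site D, A x y a f * K y z f b) - ∑' y : Site D, A x y a f * K x z f b) := by
        refine Finset.sum_congr rfl fun f _ => ?_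
        rw [hzero f, sub_zero]
    _ = ∑ f, ∑' y : Site D, A x y a f * (K y z f b - K x z f b) := by
        refine Finset.sum_congr rfl fun f _ => ?_
        rw [← ((hAK f).tsum_sub ((hAs f).mul_right (K x z f b)))]
        exact tsum_congr fun y => by ring
    _ = ∑' y : Site D, ∑ f, A x y a f * (K y z f b - K x z f b) := (Summable.tsum_finsetSum (fun f _ => hsub f)).symm

/-- [folklore] **THE DIFFERENCE BOUND, LEFT**: under the same charge-freeness, `|(A ∘ K)(x,z)_{ab}| ≤ Σ'_y Σ_f |A(x,y)_{af}|·|K(y,z)_{fb} − K(x,z)_{fb}|` (right side summable). -/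
theorem abs_comp_le_tsum_abs_mul_abs_sub {A K : MKer D F} (x z : Site D) (a b : F)
    (hA0 : ∀ f, ∑' y : Site D, A x y a f = 0) (hAs : ∀ f, Summable fun y : Site D => A x y a f)
    (hAK : ∀ f, Summable fun y : Site D => A x y a f * K y z f b)
    (hS : Summable fun y : Site D => ∑ f, |A x y a f| * |K y z f b - K x z f b|) :
    |comp A K x z a b| ≤ ∑' y : Site D, ∑ f, |A x y a f| * |K y z f b - K x z f b| := by
  rw [comp_eq_tsum_mul_sub x z a b hA0 hAs hAK]
  set g : Site D → ℝ := fun y => ∑ f, A x y a f * (K y z f b - K x z f b) with hg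
  have hpt : ∀ y, |g y| ≤ ∑ f, |A x y a f| * |K y z f b - K x z f b| := fun y =>
    (Finset.abs_sum_le_sum_abs _ _).trans (le_of_eq (Finset.sum_congr rfl fun f _ => abs_mul _ _))
  have hn : Summable fun y => ‖g y‖ := by
    simpa only [Real.norm_eq_abs] using Summable.of_nonneg_of_le (fun y => abs_nonneg (g y)) hpt hS
  have h1 : ‖∑' y, g y‖ ≤ ∑' y, ‖g y‖ := norm_tsum_le_tsum_norm hn
  simp only [Real.norm_eq_abs] at h1 hn
  exact h1.trans (Summable.tsum_le_tsum hpt hn hS)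

/-! ## §2 Column-charge-free RIGHT factor: the leg enters through its differences from ANY base point -/

/-- [folklore] **ABEL SUMMATION FOR A COLUMN-CHARGE-FREE KERNEL**: if the column `(·, z, ·, b)` of `A` is summable with total `0` in every fibre row `f`, and the
products with the leg's row are summable, then for ANY base point `p`, `(K ∘ A)(x,z)_{ab} = Σ'_y Σ_f (K(x,y)_{af} − K(x,p)_{af})·A(y,z)_{fb}`. -/
theorem comp_eq_tsum_sub_mul {K A : MKer D F} (x z p : Site D) (a b : F)
    (hA0 : ∀ f, ∑' y : Site D, A y z f b = 0) (hAs : ∀ f, Summable fun y : Site D => A y z f b)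
    (hKA : ∀ f, Summable fun y : Site D => K x y a f * A y z f b) :
    comp K A x z a b = ∑' y : Site D, ∑ f, (K x y a f - K x p a f) * A y z f b := by
  have hsub : ∀ f, Summable fun y : Site D => (K x y a f - K x p a f) * A y z f b := fun f => by
    have h := (hKA f).sub ((hAs f).mul_left (K x p a f))
    refine h.congr fun y => ?_
    ring
  have hzero : ∀ f, ∑' y : Site D, K x p a f * A y z f b = 0 := fun f => by
    rw [tsum_mul_left, hA0 f, mul_zero]
  calc comp K A x z a b = ∑' y : Site D, ∑ f, K x y a f * A y z f b := rfl
    _ = ∑ f, ∑' y : Site D, K x y a f * A y z f b := Summable.tsum_finsetSum (fun f _ => hKA f)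
    _ = ∑ f, ((∑' y : Site D, K x y a f * A y z f b) - ∑' y : Site D, K x p a f * A y z f b) := by
        refine Finset.sum_congr rfl fun f _ => ?_
        rw [hzero f, sub_zero]
    _ = ∑ f, ∑' y : Site D, (K x y a f - K x p a f) * A y z f b := by
        refine Finset.sum_congr rfl fun f _ => ?_
        rw [← ((hKA f).tsum_sub ((hAs f).mul_left (K x p a f)))]
        exact tsum_congr fun y => by ring
    _ = ∑' y : Site D, ∑ f, (K x y a f - K x p a f) * A y z f b := (Summable.tsum_finsetSum (fun f _ => hsub f)).symm

/-- [folklore] **THE DIFFERENCE BOUND, RIGHT**: `|(K ∘ A)(x,z)_{ab}| ≤ Σ'_y Σ_f |K(x,y)_{af} − K(x,p)_{af}|·|A(y,z)_{fb}|` (right side summable). -/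
theorem abs_comp_le_tsum_abs_sub_mul_abs {K A : MKer D F} (x z p : Site D) (a b : F)
    (hA0 : ∀ f, ∑' y : Site D, A y z f b = 0) (hAs : ∀ f, Summable fun y : Site D => A y z f b)
    (hKA : ∀ f, Summable fun y : Site D => K x y a f * A y z f b)
    (hS : Summable fun y : Site D => ∑ f, |K x y a f - K x p a f| * |A y z f b|) :
    |comp K A x z a b| ≤ ∑' y : Site D, ∑ f, |K x y a f - K x p a f| * |A y z f b| := by
  rw [comp_eq_tsum_sub_mul x z p a b hA0 hAs hKA]
  set g : Site D → ℝ := fun y => ∑ f, (K x y a f - K x p a f) * A y z f b with hg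
  have hpt : ∀ y, |g y| ≤ ∑ f, |K x y a f - K x p a f| * |A y z f b| := fun y =>
    (Finset.abs_sum_le_sum_abs _ _).trans (le_of_eq (Finset.sum_congr rfl fun f _ => abs_mul _ _))
  have hn : Summable fun y => ‖g y‖ := by
    simpa only [Real.norm_eq_abs] using Summable.of_nonneg_of_le (fun y => abs_nonneg (g y)) hpt hS
  have h1 : ‖∑' y, g y‖ ≤ ∑' y, ‖g y‖ := norm_tsum_le_tsum_norm hn
  simp only [Real.norm_eq_abs] at h1 hn
  exact h1.trans (Summable.tsum_le_tsum hpt hn hS)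

/-- [folklore] **THE SUPPORT PACKAGING**: if `|K(x,y)_{af} − K(x,p)_{af}| ≤ G` wherever `A(y,z)_{fb} ≠ 0`, then
`|(K ∘ A)(x,z)_{ab}| ≤ G · Σ'_y Σ_f |A(y,z)_{fb}|` — the leg costs its OSCILLATION over the stencil's support instead of its sup. -/
theorem abs_comp_le_mul_tsum_of_support {K A : MKer D F} (x z p : Site D) (a b : F) {G : ℝ}
    (hA0 : ∀ f, ∑' y : Site D, A y z f b = 0) (hAs : ∀ f, Summable fun y : Site D => A y z f b)
    (hKA : ∀ f, Summable fun y : Site D => K x y a f * A y z f b)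
    (hK : ∀ y f, A y z f b ≠ 0 → |K x y a f - K x p a f| ≤ G) :
    |comp K A x z a b| ≤ G * ∑' y : Site D, ∑ f, |A y z f b| := by
  have habs : ∀ f, Summable fun y : Site D => |A y z f b| := fun f => (hAs f).abs
  have hsumAbs : Summable fun y : Site D => ∑ f, |A y z f b| := summable_sum fun f _ => habs f
  have hpt : ∀ y, ∑ f, |K x y a f - K x p a f| * |A y z f b| ≤ ∑ f, G * |A y z f b| := fun y =>
    Finset.sum_le_sum fun f _ => by
      by_cases h0 : A y z f b = 0
      · rw [h0, abs_zero, mul_zero, mul_zero]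
      · exact mul_le_mul_of_nonneg_right (hK y f h0) (abs_nonneg _)
  have hmaj : Summable fun y : Site D => ∑ f, G * |A y z f b| := by
    simpa only [← Finset.mul_sum] using hsumAbs.mul_left G
  have hS : Summable fun y : Site D => ∑ f, |K x y a f - K x p a f| * |A y z f b| :=
    Summable.of_nonneg_of_le (fun y => Finset.sum_nonneg fun f _ => mul_nonneg (abs_nonneg _) (abs_nonneg _)) hpt hmaj
  refine (abs_comp_le_tsum_abs_sub_mul_abs x z p a b hA0 hAs hKA hS).trans ?_
  refine (Summable.tsum_le_tsum hpt hS hmaj).trans (le_of_eq ?_)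
  rw [← tsum_mul_left]
  exact tsum_congr fun y => by rw [Finset.mul_sum]

/-! ## §3 Lipschitz from unit steps: the oscillation over an `ℓ¹`-ball from the unit-difference bound -/

/-- [folklore] **TELESCOPING ALONG THE AXIAL CONTOUR**: if `|f (w + e_κ) − f w| ≤ G₁` for every `w` and `κ`, then `|f y − f p| ≤ G₁ · Σ_i |y_i − p_i|`
(the contour `Γ_{p,y}` has `Σ_i |y_i − p_i|` bonds, each letter a unit difference of `f`: `axial_sum_grad`, `mem_axial`, `axial_length`). -/
theorem abs_sub_le_mul_l1Dist_of_unitDiff_le {f : Site D → ℝ} {G₁ : ℝ} (hG : ∀ (κ : Fin D) (w : Site D), |f (w + unitVec κ) - f w| ≤ G₁) (p y : Site D) :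
    |f y - f p| ≤ G₁ * ∑ i : Fin D, (((y i - p i).natAbs : ℕ) : ℝ) := by
  rw [← axial_sum_grad f p y]
  have hletter : ∀ a ∈ axial (grad f) p y, |a| ≤ G₁ := by
    intro a ha
    obtain ⟨κ, z', e⟩ := mem_axial ha
    rcases e with e | e
    · rw [e]; exact hG κ z'
    · rw [e, abs_neg]; exact hG κ z'
  have h := abs_list_sum_le hletter
  rw [axial_length] at h
  refine h.trans (le_of_eq ?_)
  push_cast
  ring

/-! ## §4 The scalar twin along one axis (leaf-04 g25's STEP A form) -/

omit [Fintype F] in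
/-- [folklore] **SCALAR SUMMATION BY PARTS ALONG ONE AXIS**: `Σ'_u c u·(T (u + e) − T u) = −Σ'_u (c u − c (u − e))·T u` for any shift `e`, provided the two products
`c u·T (u + e)` and `c u·T u` are summable (reindex the first by `u ↦ u − e`) — the current's bond difference traded for the weight's (leaf-04 g25 «GHOST-N8-SPEC» STEP A;
the OWNER d1-p2 g23 W-g23-12 (4): one file for both consumers). -/
theorem tsum_mul_sub_eq_neg_tsum_sub_mul (c T : Site D → ℝ) (e : Site D)
    (h₁ : Summable fun u : Site D => c u * T (u + e)) (h₀ : Summable fun u : Site D => c u * T u) :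
    ∑' u : Site D, c u * (T (u + e) - T u) = -∑' u : Site D, (c u - c (u - e)) * T u := by
  have hre : ∑' u : Site D, c u * T (u + e) = ∑' v : Site D, c (v - e) * T v := by
    rw [← (Equiv.subRight e).tsum_eq]
    refine tsum_congr fun v => ?_
    simp only [Equiv.subRight_apply, sub_add_cancel]
  have h₂ : Summable fun v : Site D => c (v - e) * T v := by
    have h := (Equiv.subRight e).summable_iff.mpr h₁
    refine h.congr fun v => ?_
    simp only [Function.comp, Equiv.subRight_apply, sub_add_cancel]
  have e1 : (fun u : Site D => c u * (T (u + e) - T u)) = fun u => c u * T (u + e) - c u * T u := funext fun u => by ring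
  have e2 : (fun u : Site D => (c u - c (u - e)) * T u) = fun u => c u * T u - c (u - e) * T u := funext fun u => by ring
  rw [e1, e2, h₁.tsum_sub h₀, h₀.tsum_sub h₂, hre]
  ring

end Summit.QuantumFields.BalabanUV.Beta.D1BFx.ChargeFreeComposition

end
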